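import Summits.KontsevichZagierPeriods.KontsevichZagierPeriods.Theses.TerasomaMultiplication
import Summits.KontsevichZagierPeriods.KontsevichZagierPeriods.Theses.TerasomaCovering
import Summits.KontsevichZagierPeriods.KontsevichZagierPeriods.Theses.MellinCoarea
import Summits.KontsevichZagierPeriods.KontsevichZagierPeriods.Theorems.TerasomaMultiplicationMultiplicationThreeStubBoxToSigmaBoxAvg
import Summits.KontsevichZagierPeriods.KontsevichZagierPeriods.Theorems.TerasomaMultiplicationMultiplicationThreeStubLowerCellToNegativeBranch
import Summits.KontsevichZagierPeriods.KontsevichZagierPeriods.Theorems.TerasomaMultiplicationMultiplicationThreeStubUpperCellToLowerCell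
import Summits.KontsevichZagierPeriods.KontsevichZagierPeriods.Theorems.TerasomaMultiplicationMultiplicationThreeStubNegativeBranchToMaxCellImage
import Summits.KontsevichZagierPeriods.KontsevichZagierPeriods.Theorems.TerasomaMultiplicationMultiplicationThreeStubMaxCellToMaxCellImage
import Summits.KontsevichZagierPeriods.KontsevichZagierPeriods.Theorems.TerasomaMultiplicationMultiplicationThreeStubSimplexToMaxCell

/-!
# `MultiplicationThree` (stmt-KontsevichZagierPeriods-3598) — line `bolza-involution-real-quotient`
# (the line closes the crux)

The crux (routes TerasomaMultiplication / TerasomaCovering / MellinCoarea, same text): for every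
rational `s > 0` the box representation `[(0,1)², v₁^{-2/3}(1-v₁)^{s-1} v₂^{-1/3}(1-v₂)^{s-1}]` and the
simplex representation `[{σ₁,σ₂>0, σ₁+σ₂<3}, (σ₁σ₂(3-σ₁-σ₂))^{s-1}]` are `KZ.Equivalent`.

Line (idea card `Cruxes/MultiplicationThree/Ideas/bolza-involution-real-quotient.md`, = the route's
own lever (M3) of `Theses/TerasomaMultiplication.lean`, steps 0–(i) certified by the standing
disprover in `Cruxes/MultiplicationThree/Disproof.lean` §9, step (iii) in the promote-g2 form: Möbius
2-torsion move + cyclic symmetry of the simplex). Rules (1a)(1b)(2) only, dimension 2, uniform in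
`s` (the weight `u^{s-1}` rides in every integrand). Chain, with `f := u^{s−1}/√Q(a,u)`,
`Q(a,u) = a²(3−a)² − 4ua`, `g := (σ₁σ₂σ₃)^{s−1}`:

  box ~ [Σ_box, u^{s−1}(ψ+ψ̄)/2]                       (stub S1: shear + involution average)
      = [lowerCell] + [upperCell]  (null cut v = 1 − √u, rule 1a)
  [upperCell, ·] ~ [lowerCell, ·]                       (stub S3: the involution swaps the cells)
  [lowerCell, u^{s−1}(ψ+ψ̄)/2] ~ [Σ_neg, (3/2) f]        (stub S2: cube-root chart, HARDEST)
  hence box ~ [Σ_neg, 3f] ~ 3·[Σ_neg, f]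
  [Σ_neg, f] ~ [maxCellImage, f]                       (stub S4: Möbius 2-torsion translation)
  [M₃, g] ~ [maxCellImage, f]                          (stub S5: coarea shear on the max cell)
  Δ ~ [M₃, 3g] ~ 3·[M₃, g]                             (stub S6: cyclic symmetry of the simplex)

The six stubs were registered on the item (`ledger skeleton check`) and are PROVED in the six imported
`Theorems/TerasomaMultiplicationMultiplicationThreeStub*.lean` files (+ their `…Aux` helpers);
`MultiplicationThree_of` is their composition. Nothing is defined in this file: the cells are written
out (lower cell `{0<u, 0<v, v<1−u, u<(1−v)²}`, upper cell `{…, (1−v)²<u}` of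
`Σ_box = {0<u, 0<v<1−u}`; max cell `M₃ = {0<σ₁, 0<σ₂, σ₁<σ₃, σ₂<σ₃}`).
-/

noncomputable section

open Set MeasureTheory

namespace Summit.KontsevichZagierPeriods.TerasomaMultiplication.MultiplicationThreeBolza

open Literature.NumberTheory.Transcendental
open Literature.NumberTheory.Transcendental.KZ
open Literature.ModelTheory.ExponentialFields (IsSemialgebraic)
open MvPolynomial (aeval X C)
open Summit.KontsevichZagierPeriods.KontsevichZagierPeriods.Theses.TerasomaMultiplication
  (MultiplicationThree)

/-! ## Glue: vocabulary, null cut, bookkeeping -/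

/-- The two cells are disjoint. [folklore] -/
theorem bolza_lowerCell_inter_upperCell :
    {x : Fin 2 → ℝ | 0 < x 0 ∧ 0 < x 1 ∧ x 1 < 1 - x 0 ∧ x 0 < (1 - x 1) ^ 2} ∩
      {x : Fin 2 → ℝ | 0 < x 0 ∧ 0 < x 1 ∧ x 1 < 1 - x 0 ∧ (1 - x 1) ^ 2 < x 0} = ∅ := by
  ext x
  simp only [mem_inter_iff, mem_setOf_eq, mem_empty_iff_false, iff_false]
  rintro ⟨⟨-, -, -, h⟩, ⟨-, -, -, h'⟩⟩
  linarith

/-- `Σ_box` minus the two cells lies on the cut `v = 1 − √u`, the graph of a semialgebraic function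
of the base. [folklore] -/
theorem bolza_sigmaBox_diff_cells_subset :
    {x : Fin 2 → ℝ | 0 < x 0 ∧ 0 < x 1 ∧ x 1 < 1 - x 0} \
      ({x : Fin 2 → ℝ | 0 < x 0 ∧ 0 < x 1 ∧ x 1 < 1 - x 0 ∧ x 0 < (1 - x 1) ^ 2} ∪
        {x : Fin 2 → ℝ | 0 < x 0 ∧ 0 < x 1 ∧ x 1 < 1 - x 0 ∧ (1 - x 1) ^ 2 < x 0}) ⊆
      {z : Fin (1 + 1) → ℝ | Fin.init z ∈ (univ : Set (Fin 1 → ℝ)) ∧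
        z (Fin.last 1) = (fun w : Fin 1 → ℝ => 1 - Real.sqrt (w 0)) (Fin.init z)} := by
  rintro x ⟨⟨h0, h1, h2⟩, hx⟩
  simp only [mem_union, not_or, mem_setOf_eq, not_and, not_lt] at hx
  obtain ⟨hlo, hhi⟩ := hx
  have a := hlo h0 h1 h2
  have b := hhi h0 h1 h2
  have heq : x 0 = (1 - x 1) ^ 2 := le_antisymm b a
  refine ⟨mem_univ _, ?_⟩
  change x 1 = 1 - Real.sqrt (x 0)
  rw [heq, Real.sqrt_sq (by linarith)]
  ring

/-- The cut is null. [folklore] -/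
theorem bolza_volume_sigmaBox_diff_cells :
    volume ({x : Fin 2 → ℝ | 0 < x 0 ∧ 0 < x 1 ∧ x 1 < 1 - x 0} \
      ({x : Fin 2 → ℝ | 0 < x 0 ∧ 0 < x 1 ∧ x 1 < 1 - x 0 ∧ x 0 < (1 - x 1) ^ 2} ∪
        {x : Fin 2 → ℝ | 0 < x 0 ∧ 0 < x 1 ∧ x 1 < 1 - x 0 ∧ (1 - x 1) ^ 2 < x 0})) = 0 := by
  have hu : IsSemialgebraicFunOn ℚ (univ : Set (Fin 1 → ℝ)) (fun w : Fin 1 → ℝ => 1 - Real.sqrt (w 0)) := by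
    have h1 : IsSemialgebraicFunOn ℚ (univ : Set (Fin 1 → ℝ)) (fun _ => (1:ℝ)) :=
      (isSemialgebraicFunOn_aeval Literature.ModelTheory.ExponentialFields.isSemialgebraic_univ
        (1 : MvPolynomial (Fin 1) ℚ)).congr fun x _ => by simp
    exact IsSemialgebraicFunOn.sub_holds h1 isSemialgebraicFunOn_sqrt_univ
  exact measure_mono_null bolza_sigmaBox_diff_cells_subset (volume_graph_eq_zero hu)

/-! ## The composition -/

/-- **The line closes the crux** (composition of the six stubs). With `R₁ = [Σ_box, u^{s−1}(ψ+ψ̄)/2]`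
(S1), split `R₁` along the null cut into its two cells (rule 1a); push the lower cell to
`R₂ = [Σ_neg, (3/2)f]` (S2) and the upper cell to the lower cell (S3), so `[box] ~ 2[R₂] ~ [Σ_neg, 3f]
~ 3[N]`, `N = [Σ_neg, f] = (2/3)·R₂`; then `N ~ [maxCellImage, f] ~ [M₃, g]` (S4, S5) and
`[Δ] ~ [M₃, 3g] ~ 3[M₃, g]` (S6, rule 1b). [folklore] -/
theorem MultiplicationThree_of : MultiplicationThree := by
  intro s hs r r' hr hri hr' hri'
  -- S1: the averaged sheared box representation
  obtain ⟨⟨R₁, hR₁d, hR₁i⟩, hS1⟩ := stub_boxToSigmaBoxAvg s hs r hr hri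
  have e1 : Equivalent r R₁ := hS1 R₁ hR₁d hR₁i
  -- the two cells of Σ_box
  have hAsub : {x : Fin 2 → ℝ | 0 < x 0 ∧ 0 < x 1 ∧ x 1 < 1 - x 0 ∧ x 0 < (1 - x 1) ^ 2} ⊆
      R₁.domain := by
    rw [hR₁d]; rintro x ⟨h0, h1, h2, -⟩; exact ⟨h0, h1, h2⟩
  have hBsub : {x : Fin 2 → ℝ | 0 < x 0 ∧ 0 < x 1 ∧ x 1 < 1 - x 0 ∧ (1 - x 1) ^ 2 < x 0} ⊆
      R₁.domain := by
    rw [hR₁d]; rintro x ⟨h0, h1, h2, -⟩; exact ⟨h0, h1, h2⟩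
  set A := R₁.restrict _ s2_isSemialgebraic_lowerCell hAsub with hA
  set B := R₁.restrict _ s3_isSemialgebraic_upperCell hBsub with hB
  have hE : IsSemialgebraic ℚ
      ({x : Fin 2 → ℝ | 0 < x 0 ∧ 0 < x 1 ∧ x 1 < 1 - x 0 ∧ x 0 < (1 - x 1) ^ 2} ∪
        {x : Fin 2 → ℝ | 0 < x 0 ∧ 0 < x 1 ∧ x 1 < 1 - x 0 ∧ (1 - x 1) ^ 2 < x 0}) :=
    s2_isSemialgebraic_lowerCell.union s3_isSemialgebraic_upperCell
  have hEsub : {x : Fin 2 → ℝ | 0 < x 0 ∧ 0 < x 1 ∧ x 1 < 1 - x 0 ∧ x 0 < (1 - x 1) ^ 2} ∪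
      {x : Fin 2 → ℝ | 0 < x 0 ∧ 0 < x 1 ∧ x 1 < 1 - x 0 ∧ (1 - x 1) ^ 2 < x 0} ⊆ R₁.domain :=
    union_subset hAsub hBsub
  -- (1a) cut out the null curve, then split
  have c1 : of R₁ - of (R₁.restrict _ hE hEsub) ∈ relations :=
    KZ.IntegralRep.of_sub_of_restrict_mem_relations _ hE hEsub
      (by rw [hR₁d]; exact bolza_volume_sigmaBox_diff_cells)
  have c2 : of (R₁.restrict _ hE hEsub) - of A - of B ∈ relations := by
    refine domainAddRel_subset_relations ⟨2, R₁.restrict _ hE hEsub, A, B, rfl, ?_,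
      fun _ _ => rfl, fun _ _ => rfl, rfl⟩
    simp [hA, hB, bolza_lowerCell_inter_upperCell]
  -- S2 on the lower cell
  have hAi : EqOn A.integrand _ A.domain := fun x hx => hR₁i (hAsub hx)
  obtain ⟨⟨R₂, hR₂d, hR₂i⟩, hS2⟩ := stub_lowerCellToNegativeBranch s hs A rfl hAi
  have e2 : Equivalent A R₂ := hS2 R₂ hR₂d hR₂i
  -- S3: the upper cell is equivalent to the lower cell
  have hBi : EqOn B.integrand _ B.domain := fun x hx => hR₁i (hBsub hx)
  have e3 : Equivalent B A := stub_upperCellToLowerCell s hs B A rfl hBi rfl hAi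
  -- N = [Σ_neg, f] := (2/3) · R₂
  have h23 : IsAlgebraic ℚ ((2/3 : ℚ) : ℝ) := isAlgebraic_algebraMap _
  set N := R₂.constMul ((2/3 : ℚ) : ℝ) h23 with hN
  have hNd : N.domain = {x | 0 < x 0 ∧ x 0 < 1 ∧ x 1 < 0} := by rw [hN, IntegralRep.domain_constMul, hR₂d]
  have hNi : EqOn N.integrand (fun x => (x 0) ^ ((s:ℝ) - 1) /
      Real.sqrt ((x 1) ^ 2 * (3 - x 1) ^ 2 - 4 * x 0 * x 1)) N.domain := by
    intro x hx
    rw [hN, IntegralRep.integrand_constMul]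
    simp only
    rw [hR₂i (by simpa [hN] using hx)]
    push_cast
    ring
  -- [R₂.constMul 2] ~ [N.constMul 3]: same domain, both integrands are 3f
  have c3 : of (R₂.constMul ((2:ℕ):ℝ) (isAlgebraic_nat 2)) -
      of (N.constMul ((3:ℕ):ℝ) (isAlgebraic_nat 3)) ∈ relations := by
    refine of_sub_of_mem_relations_of_eqOn (by simp [hN]) fun x hx => ?_
    simp only [IntegralRep.integrand_constMul, hN]
    simp only [IntegralRep.domain_constMul] at hx
    rw [hR₂i hx]
    push_cast
    ring
  have c4 := R₂.of_constMul_nat_sub_nsmul_mem_relations 2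
  have c5 := N.of_constMul_nat_sub_nsmul_mem_relations 3
  -- S4, S5: N ~ [maxCellImage, f] ~ M := r' restricted to the max cell
  obtain ⟨⟨R₄, hR₄d, hR₄i⟩, hS4⟩ := stub_negativeBranchToMaxCellImage s hs N hNd hNi
  have e4 : Equivalent N R₄ := hS4 R₄ hR₄d hR₄i
  have hMsub : {x : Fin 2 → ℝ | 0 < x 0 ∧ 0 < x 1 ∧ x 0 < 3 - x 0 - x 1 ∧ x 1 < 3 - x 0 - x 1} ⊆
      r'.domain := by
    rw [hr']; rintro x ⟨h0, h1, h2, -⟩; exact ⟨h0, h1, by linarith⟩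
  set M := r'.restrict _
    Summit.KontsevichZagierPeriods.TerasomaMultiplication.SimplexToMaxCell.isSemialgebraic_cellThree hMsub
    with hM
  have hMi : EqOn M.integrand (fun x => (x 0 * x 1 * (3 - x 0 - x 1)) ^ ((s:ℝ) - 1)) M.domain :=
    fun x hx => hri' (hMsub hx)
  have e5 : Equivalent M R₄ := stub_maxCellToMaxCellImage s hs M R₄ rfl hMi hR₄d hR₄i
  -- S6: r' ~ [M₃, 3g] = M.constMul 3
  have e6 : Equivalent r' (M.constMul ((3:ℕ):ℝ) (isAlgebraic_nat 3)) := by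
    refine stub_simplexToMaxCell s hs r' _ hr' hri' rfl fun x hx => ?_
    simp only [IntegralRep.integrand_constMul]
    rw [hMi hx]
    push_cast
    ring
  have c6 := M.of_constMul_nat_sub_nsmul_mem_relations 3
  -- bookkeeping in FormalRep ⧸ relations
  have eNM : of N - of M ∈ relations := e4.trans e5.symm
  have e3NM : (3 : ℕ) • (of N - of M) ∈ relations := relations.nsmul_mem eNM 3
  show of r - of r' ∈ relations
  have key : of r - of r' =
      (of r - of R₁) + (of R₁ - of (R₁.restrict _ hE hEsub)) +
      (of (R₁.restrict _ hE hEsub) - of A - of B) + (of B - of A) + 2 • (of A - of R₂) -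
      (of (R₂.constMul ((2:ℕ):ℝ) (isAlgebraic_nat 2)) - 2 • of R₂) +
      (of (R₂.constMul ((2:ℕ):ℝ) (isAlgebraic_nat 2)) - of (N.constMul ((3:ℕ):ℝ) (isAlgebraic_nat 3))) +
      (of (N.constMul ((3:ℕ):ℝ) (isAlgebraic_nat 3)) - 3 • of N) +
      (3 : ℕ) • (of N - of M) -
      (of (M.constMul ((3:ℕ):ℝ) (isAlgebraic_nat 3)) - 3 • of M) -
      (of r' - of (M.constMul ((3:ℕ):ℝ) (isAlgebraic_nat 3))) := by
    simp only [smul_sub]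
    abel
  rw [key]
  refine relations.sub_mem (relations.sub_mem (relations.add_mem (relations.add_mem
    (relations.add_mem (relations.sub_mem (relations.add_mem (relations.add_mem (relations.add_mem
    (relations.add_mem e1 c1) c2) e3) (relations.nsmul_mem e2 2)) c4) c3) c5) e3NM) c6) e6

/-- The crux of route TerasomaMultiplication, by name. [folklore] -/
theorem MultiplicationThree_proof :
    Summit.KontsevichZagierPeriods.KontsevichZagierPeriods.Theses.TerasomaMultiplication.MultiplicationThree :=
  MultiplicationThree_of

/-- The same decl of route TerasomaCovering (identical text). [folklore] -/
theorem MultiplicationThree_proof_covering :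
    Summit.KontsevichZagierPeriods.KontsevichZagierPeriods.Theses.TerasomaCovering.MultiplicationThree :=
  MultiplicationThree_of

/-- The same decl of route MellinCoarea (identical text). [folklore] -/
theorem MultiplicationThree_proof_mellin :
    Summit.KontsevichZagierPeriods.KontsevichZagierPeriods.Theses.MellinCoarea.MultiplicationThree :=
  MultiplicationThree_of

end Summit.KontsevichZagierPeriods.TerasomaMultiplication.MultiplicationThreeBolza

end
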